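import Summits.Ventures.PercRepro.PuncturedLYMRecSum2
import Summits.Ventures.PercRepro.PuncturedLYMAvoidMain

/-!
# PercRepro — (SP) BY SUPERPOSITION, PART 16: THEOREM G — (SP) FOR EVERY CODE WITH `2j + 1 ≤ n`; (NC) FOR EVERY SPARSE
PAVING MATROID WITH `r + 1 ≤ n ≤ 2r − 2` (p10, gen 32)

The greedy certificates are nonnegative (PuncturedLYMRecCert) and their weighted sums have closed-form upper bounds
(PuncturedLYMRecSum): `Nʸ ≤ U₁ := (j − j(j+1)/n + 1/(n−j−1))/(n−j)` and, with `τ ≤ 2(n−j)/(n(n−1))` (`tauQ_le`),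
`Q ≤ U₂ := (j − 1 − j(j+1)/n + 2(n−j)/(n(n−1)) + 2/(n−j−1))/(n−j+1)`.  The bound of `puncturedNMP_of_cert3` is at most
`U₁·(1 + 1/j) + U₂`, and `1 − U₁·(1 + 1/j) − U₂ = P(t, u)/D(t, u)` with `j = u + 3`, `n = 2u + 7 + t` and `P` a polynomial
with POSITIVE coefficients (`allj_key`: 26 monomials, constant term 1752).  Hence:
* **`puncturedNMP_all`** (THEOREM G) — (SP) holds for every code `D ⊆ C([n], j)` with `1 ≤ j` and `2j + 1 ≤ n`;
* `puncturedNMP_in_all` — the same inside any finset;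
* **`Cogirth.normConsAt_of_sparsePaving_all`** — (NC) holds for every sparse paving matroid with `r + 1 ≤ n ≤ 2r − 2`, on
  any ground set.
-/

open scoped Matroid

namespace PercRepro.PuncturedLYM

open Finset

variable {α : Type} [Fintype α]

/-- `τ ≤ 2(n − j)/(n(n − 1))` for `1 ≤ j`, `j + 3 ≤ n` (`C(n, 2) ≤ C(n, j+1)`). -/
theorem tauQ_le {j : ℕ} (hj : 1 ≤ j) (hn : j + 3 ≤ Fintype.card α) :
    tauQ α j ≤ 2 * ((Fintype.card α : ℚ) - j) / ((Fintype.card α : ℚ) * ((Fintype.card α : ℚ) - 1)) := by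
  unfold tauQ
  obtain ⟨n, hn_def⟩ : ∃ n, Fintype.card α = n := ⟨_, rfl⟩
  rw [hn_def] at hn ⊢
  have h2 := choose_two_le_choose n (j + 1) (by omega) (by omega)
  have hC2 : ((n.choose 2 : ℕ) : ℚ) = (n : ℚ) * ((n : ℚ) - 1) / 2 := Nat.cast_choose_two ℚ n
  have hC2pos : (0 : ℚ) < (n.choose 2 : ℕ) := by exact_mod_cast Nat.choose_pos (by omega)
  have hCpos : (0 : ℚ) < (n.choose (j + 1) : ℕ) := by exact_mod_cast Nat.choose_pos (by omega)
  have hN : (0 : ℚ) ≤ (n : ℚ) - j := by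
    have : (j : ℚ) ≤ n := by exact_mod_cast (by omega : j ≤ n)
    linarith
  have hn1 : (0 : ℚ) < (n : ℚ) * ((n : ℚ) - 1) := by
    have : (4 : ℚ) ≤ n := by exact_mod_cast (by omega : 4 ≤ n)
    nlinarith
  calc ((n : ℚ) - j) / (n.choose (j + 1) : ℕ) ≤ ((n : ℚ) - j) / (n.choose 2 : ℕ) := by
        apply div_le_div_of_nonneg_left hN hC2pos
        exact_mod_cast h2
    _ = 2 * ((n : ℚ) - j) / ((n : ℚ) * ((n : ℚ) - 1)) := by
        rw [hC2]
        field_simp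

/-- **The polynomial certificate**: with `j = u + 3` and `n = 2u + 7 + t`,
`U₁·(1 + 1/j) + U₂ ≤ 1` — the difference is `P(t, u)/D(t, u)` with `P` a polynomial with positive coefficients. -/
theorem allj_key (j n : ℚ) (u t : ℕ) (hj : j = u + 3) (hn : n = 2 * (u + 3) + 1 + (t : ℚ)) :
    ((j - j * (j + 1) / n + 1 / (n - j - 1)) / (n - j)) * (1 + 1 / j) +
      (j - 1 - j * (j + 1) / n + 2 * (n - j) / (n * (n - 1)) + 2 / (n - j - 1)) / (n - j + 1) ≤ 1 := by
  subst hj hn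
  have hu : (0 : ℚ) ≤ u := by positivity
  have ht : (0 : ℚ) ≤ t := by positivity
  have hD : (0 : ℚ) < ((u : ℚ) + 3) * (2 * (u : ℚ) + 7 + t) * (2 * (u : ℚ) + 6 + t) * ((u : ℚ) + 4 + t) *
      ((u : ℚ) + 3 + t) * ((u : ℚ) + 5 + t) := by positivity
  have hP : (0 : ℚ) ≤ (1752 +
        3494 * (u : ℚ) +
        2572 * (u : ℚ) ^ 2 +
        900 * (u : ℚ) ^ 3 +
        152 * (u : ℚ) ^ 4 +
        10 * (u : ℚ) ^ 5 +
        2926 * (t : ℚ) +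
        4273 * (t : ℚ) * (u : ℚ) +
        2326 * (t : ℚ) * (u : ℚ) ^ 2 +
        580 * (t : ℚ) * (u : ℚ) ^ 3 +
        63 * (t : ℚ) * (u : ℚ) ^ 4 +
        2 * (t : ℚ) * (u : ℚ) ^ 5 +
        1623 * (t : ℚ) ^ 2 +
        1835 * (t : ℚ) ^ 2 * (u : ℚ) +
        740 * (t : ℚ) ^ 2 * (u : ℚ) ^ 2 +
        124 * (t : ℚ) ^ 2 * (u : ℚ) ^ 3 +
        7 * (t : ℚ) ^ 2 * (u : ℚ) ^ 4 +
        431 * (t : ℚ) ^ 3 +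
        369 * (t : ℚ) ^ 3 * (u : ℚ) +
        102 * (t : ℚ) ^ 3 * (u : ℚ) ^ 2 +
        9 * (t : ℚ) ^ 3 * (u : ℚ) ^ 3 +
        57 * (t : ℚ) ^ 4 +
        34 * (t : ℚ) ^ 4 * (u : ℚ) +
        5 * (t : ℚ) ^ 4 * (u : ℚ) ^ 2 +
        3 * (t : ℚ) ^ 5 +
        1 * (t : ℚ) ^ 5 * (u : ℚ)) := by positivity
  generalize hx : (u : ℚ) = x at *
  generalize hy : (t : ℚ) = y at *
  have hn0 : (0 : ℚ) < (2 * (x + 3) + 1 + y) := by linarith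
  have hN0 : (0 : ℚ) < ((2 * (x + 3) + 1 + y) - (x + 3)) := by linarith
  have hN1 : (0 : ℚ) < ((2 * (x + 3) + 1 + y) - (x + 3) - 1) := by linarith
  have hN2 : (0 : ℚ) < ((2 * (x + 3) + 1 + y) - (x + 3) + 1) := by linarith
  have hn1 : (0 : ℚ) < ((2 * (x + 3) + 1 + y) - 1) := by linarith
  have hj : (0 : ℚ) < (x + 3) := by linarith
  have hnn1 : (0 : ℚ) < (2 * (x + 3) + 1 + y) * ((2 * (x + 3) + 1 + y) - 1) := mul_pos hn0 hn1
  have hnnn1 : (0 : ℚ) < (2 * (x + 3) + 1 + y) * ((2 * (x + 3) + 1 + y) * ((2 * (x + 3) + 1 + y) - 1)) := mul_pos hn0 hnn1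
  have eU1 : (((x + 3) - (x + 3) * ((x + 3) + 1) / (2 * (x + 3) + 1 + y) + 1 / ((2 * (x + 3) + 1 + y) - (x + 3) - 1)) / ((2 * (x + 3) + 1 + y) - (x + 3))) = (((x + 3) * (2 * (x + 3) + 1 + y) - (x + 3) * ((x + 3) + 1)) * ((2 * (x + 3) + 1 + y) - (x + 3) - 1) + (2 * (x + 3) + 1 + y) * 1) / ((2 * (x + 3) + 1 + y) * ((2 * (x + 3) + 1 + y) - (x + 3) - 1) * ((2 * (x + 3) + 1 + y) - (x + 3))) := by
    rw [sub_div' hn0.ne', div_add_div _ _ hn0.ne' hN1.ne', div_div]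
  have eU2 : (((x + 3) - 1 - (x + 3) * ((x + 3) + 1) / (2 * (x + 3) + 1 + y) + 2 * ((2 * (x + 3) + 1 + y) - (x + 3)) / ((2 * (x + 3) + 1 + y) * ((2 * (x + 3) + 1 + y) - 1)) + 2 / ((2 * (x + 3) + 1 + y) - (x + 3) - 1)) / ((2 * (x + 3) + 1 + y) - (x + 3) + 1)) = (((((x + 3) - 1) * (2 * (x + 3) + 1 + y) - (x + 3) * ((x + 3) + 1)) * ((2 * (x + 3) + 1 + y) * ((2 * (x + 3) + 1 + y) - 1)) + (2 * (x + 3) + 1 + y) * (2 * ((2 * (x + 3) + 1 + y) - (x + 3)))) * ((2 * (x + 3) + 1 + y) - (x + 3) - 1) + ((2 * (x + 3) + 1 + y) * ((2 * (x + 3) + 1 + y) * ((2 * (x + 3) + 1 + y) - 1))) * 2) / ((2 * (x + 3) + 1 + y) * ((2 * (x + 3) + 1 + y) * ((2 * (x + 3) + 1 + y) - 1)) * ((2 * (x + 3) + 1 + y) - (x + 3) - 1) * ((2 * (x + 3) + 1 + y) - (x + 3) + 1)) := by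
    rw [sub_div' hn0.ne', div_add_div _ _ hn0.ne' hnn1.ne', div_add_div _ _ hnnn1.ne' hN1.ne', div_div]
  have ej : (1 : ℚ) + 1 / (x + 3) = (x + 4) / (x + 3) := by
    rw [one_add_div hj.ne']
    ring
  have hD1 : (0 : ℚ) < ((2 * (x + 3) + 1 + y) * ((2 * (x + 3) + 1 + y) - (x + 3) - 1) * ((2 * (x + 3) + 1 + y) - (x + 3))) * (x + 3) := by positivity
  have hD2 : (0 : ℚ) < ((2 * (x + 3) + 1 + y) * ((2 * (x + 3) + 1 + y) * ((2 * (x + 3) + 1 + y) - 1)) * ((2 * (x + 3) + 1 + y) - (x + 3) - 1) * ((2 * (x + 3) + 1 + y) - (x + 3) + 1)) := by positivity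
  rw [eU1, eU2, ej, div_mul_div_comm, div_add_div _ _ hD1.ne' hD2.ne', div_le_one (mul_pos hD1 hD2)]
  have e : ((2 * (x + 3) + 1 + y) * ((2 * (x + 3) + 1 + y) - (x + 3) - 1) * ((2 * (x + 3) + 1 + y) - (x + 3))) * (x + 3) * ((2 * (x + 3) + 1 + y) * ((2 * (x + 3) + 1 + y) * ((2 * (x + 3) + 1 + y) - 1)) * ((2 * (x + 3) + 1 + y) - (x + 3) - 1) * ((2 * (x + 3) + 1 + y) - (x + 3) + 1)) - ((((x + 3) * (2 * (x + 3) + 1 + y) - (x + 3) * ((x + 3) + 1)) * ((2 * (x + 3) + 1 + y) - (x + 3) - 1) + (2 * (x + 3) + 1 + y) * 1) * (x + 4) * ((2 * (x + 3) + 1 + y) * ((2 * (x + 3) + 1 + y) * ((2 * (x + 3) + 1 + y) - 1)) * ((2 * (x + 3) + 1 + y) - (x + 3) - 1) * ((2 * (x + 3) + 1 + y) - (x + 3) + 1)) + ((2 * (x + 3) + 1 + y) * ((2 * (x + 3) + 1 + y) - (x + 3) - 1) * ((2 * (x + 3) + 1 + y) - (x + 3))) * (x + 3) * (((((x + 3)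 - 1) * (2 * (x + 3) + 1 + y) - (x + 3) * ((x + 3) + 1)) * ((2 * (x + 3) + 1 + y) * ((2 * (x + 3) + 1 + y) - 1)) + (2 * (x + 3) + 1 + y) * (2 * ((2 * (x + 3) + 1 + y) - (x + 3)))) * ((2 * (x + 3) + 1 + y) - (x + 3) - 1) + ((2 * (x + 3) + 1 + y) * ((2 * (x + 3) + 1 + y) * ((2 * (x + 3) + 1 + y) - 1))) * 2)) =
      (1752 +
        3494 * x +
        2572 * x ^ 2 +
        900 * x ^ 3 +
        152 * x ^ 4 +
        10 * x ^ 5 +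
        2926 * y +
        4273 * y * x +
        2326 * y * x ^ 2 +
        580 * y * x ^ 3 +
        63 * y * x ^ 4 +
        2 * y * x ^ 5 +
        1623 * y ^ 2 +
        1835 * y ^ 2 * x +
        740 * y ^ 2 * x ^ 2 +
        124 * y ^ 2 * x ^ 3 +
        7 * y ^ 2 * x ^ 4 +
        431 * y ^ 3 +
        369 * y ^ 3 * x +
        102 * y ^ 3 * x ^ 2 +
        9 * y ^ 3 * x ^ 3 +
        57 * y ^ 4 +
        34 * y ^ 4 * x +
        5 * y ^ 4 * x ^ 2 +
        3 * y ^ 5 +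
        1 * y ^ 5 * x) * (2 * (x + 3) + 1 + y) * ((2 * (x + 3) + 1 + y) - (x + 3) - 1) * (2 * (x + 3) + 1 + y) := by ring
  have hPP : (0 : ℚ) ≤ (1752 +
        3494 * x +
        2572 * x ^ 2 +
        900 * x ^ 3 +
        152 * x ^ 4 +
        10 * x ^ 5 +
        2926 * y +
        4273 * y * x +
        2326 * y * x ^ 2 +
        580 * y * x ^ 3 +
        63 * y * x ^ 4 +
        2 * y * x ^ 5 +
        1623 * y ^ 2 +
        1835 * y ^ 2 * x +
        740 * y ^ 2 * x ^ 2 +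
        124 * y ^ 2 * x ^ 3 +
        7 * y ^ 2 * x ^ 4 +
        431 * y ^ 3 +
        369 * y ^ 3 * x +
        102 * y ^ 3 * x ^ 2 +
        9 * y ^ 3 * x ^ 3 +
        57 * y ^ 4 +
        34 * y ^ 4 * x +
        5 * y ^ 4 * x ^ 2 +
        3 * y ^ 5 +
        1 * y ^ 5 * x) * (2 * (x + 3) + 1 + y) * ((2 * (x + 3) + 1 + y) - (x + 3) - 1) * (2 * (x + 3) + 1 + y) := by positivity
  linarith [e, hPP]

variable [DecidableEq α]

/-- **THEOREM G: (SP) holds for every code `D ⊆ C([n], j)` with `1 ≤ j` and `2j + 1 ≤ n`.** -/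
theorem puncturedNMP_all {j : ℕ} {D : Finset (Finset α)} (hD : IsCode j D) (hj1 : 1 ≤ j)
    (hn : 2 * j + 1 ≤ Fintype.card α) : PuncturedNMP j D := by
  rcases Nat.lt_or_ge j 3 with hj | hj
  · exact puncturedNMP_of_le_seven hD hj1 (by omega) hn
  obtain ⟨u, rfl⟩ : ∃ u, j = u + 3 := ⟨j - 3, by omega⟩
  obtain ⟨t, ht⟩ : ∃ t, Fintype.card α = 2 * (u + 3) + 1 + t := ⟨Fintype.card α - (2 * (u + 3) + 1), by omega⟩
  have hj2 : 2 ≤ u + 3 := by omega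
  refine puncturedNMP_of_cert3 hD hj2 hn (lamRec α (u + 3)) (muRec α (u + 3))
    (fun a ha => (lamRec_nonneg_le hn a ha).1) (lamRec_cert (by omega))
    (fun a ha => (muRec_nonneg_le hn a ha).1) muRec_cert ?_
  -- the bound
  set S := ∑ a ∈ range (u + 3), lamRec α (u + 3) a * sQy α (u + 3) a with hS_def
  set S' := ∑ a ∈ range (u + 3 - 1), lamRec α (u + 3) a * sQy α (u + 3) a with hS'_def
  set Q := ∑ a ∈ range (u + 3 - 1), muRec α (u + 3) a * sQ' α (u + 3) a with hQ_def
  have hS0 : 0 ≤ S := sum_nonneg (fun a ha => mul_nonneg (lamRec_nonneg_le hn a (mem_range.1 ha)).1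
    (by unfold sQy; positivity))
  have hQ0 : 0 ≤ Q := sum_nonneg (fun a ha => mul_nonneg (muRec_nonneg_le hn a (by have := mem_range.1 ha; omega)).1
    (by unfold sQ'; positivity))
  have hS'S : S' ≤ S := by
    apply sum_le_sum_of_subset_of_nonneg (range_subset_range.2 (by omega))
    intro a ha _
    exact mul_nonneg (lamRec_nonneg_le hn a (mem_range.1 ha)).1 (by unfold sQy; positivity)
  have hjq : (0 : ℚ) < ((u + 3 : ℕ) : ℚ) := by positivity
  -- the closed-form bounds
  have hU1 := sum_lamRec_le (α := α) (j := u + 3) (by omega) hn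
  have hU2 := sum_muRec_le (α := α) (j := u + 3) hj2 hn
  have hτ := tauQ_le (α := α) (j := u + 3) (by omega) (by omega)
  have hN1 : (0 : ℚ) < (Fintype.card α : ℚ) - ((u + 3 : ℕ) : ℚ) + 1 := by
    have : ((u + 3 : ℕ) : ℚ) + 1 ≤ Fintype.card α := by exact_mod_cast (by omega : u + 3 + 1 ≤ Fintype.card α)
    linarith
  have hU2' : Q ≤ (((u + 3 : ℕ) : ℚ) - 1 - ((u + 3 : ℕ) : ℚ) * (((u + 3 : ℕ) : ℚ) + 1) / Fintype.card α +
      2 * ((Fintype.card α : ℚ) - ((u + 3 : ℕ) : ℚ)) / ((Fintype.card α : ℚ) * ((Fintype.card α : ℚ) - 1)) +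
      2 / ((Fintype.card α : ℚ) - ((u + 3 : ℕ) : ℚ) - 1)) / ((Fintype.card α : ℚ) - ((u + 3 : ℕ) : ℚ) + 1) := by
    calc Q ≤ _ := hU2
      _ ≤ _ := by
        apply div_le_div_of_nonneg_right _ hN1.le
        linarith [hτ]
  have hkey := allj_key ((u + 3 : ℕ) : ℚ) (Fintype.card α : ℚ) u t (by push_cast; ring) (by rw [ht]; push_cast; ring)
  -- assemble: `S + (max S' Q + (j − 1) Q)/j ≤ S (1 + 1/j) + Q ≤ U₁ (1 + 1/j) + U₂ ≤ 1`
  set U1 := (((u + 3 : ℕ) : ℚ) - ((u + 3 : ℕ) : ℚ) * (((u + 3 : ℕ) : ℚ) + 1) / Fintype.card α +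
      1 / ((Fintype.card α : ℚ) - ((u + 3 : ℕ) : ℚ) - 1)) / ((Fintype.card α : ℚ) - ((u + 3 : ℕ) : ℚ)) with hU1_def
  set U2 := (((u + 3 : ℕ) : ℚ) - 1 - ((u + 3 : ℕ) : ℚ) * (((u + 3 : ℕ) : ℚ) + 1) / Fintype.card α +
      2 * ((Fintype.card α : ℚ) - ((u + 3 : ℕ) : ℚ)) / ((Fintype.card α : ℚ) * ((Fintype.card α : ℚ) - 1)) +
      2 / ((Fintype.card α : ℚ) - ((u + 3 : ℕ) : ℚ) - 1)) / ((Fintype.card α : ℚ) - ((u + 3 : ℕ) : ℚ) + 1) with hU2_def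
  have hmax : max S' Q ≤ S + Q := by
    apply max_le
    · linarith
    · linarith
  have h1 : (max S' Q + (((u + 3 : ℕ) : ℚ) - 1) * Q) / ((u + 3 : ℕ) : ℚ) ≤ S / ((u + 3 : ℕ) : ℚ) + Q := by
    rw [div_le_iff₀ hjq]
    have : (S / ((u + 3 : ℕ) : ℚ) + Q) * ((u + 3 : ℕ) : ℚ) = S + Q * ((u + 3 : ℕ) : ℚ) := by
      field_simp
    rw [this]
    nlinarith [hmax]
  have h2 : S / ((u + 3 : ℕ) : ℚ) ≤ U1 / ((u + 3 : ℕ) : ℚ) := div_le_div_of_nonneg_right hU1 hjq.le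
  have h3 : U1 * (1 + 1 / ((u + 3 : ℕ) : ℚ)) = U1 + U1 / ((u + 3 : ℕ) : ℚ) := by ring
  rw [h3] at hkey
  linarith [h1, h2, hU1, hU2', hkey]

omit [Fintype α] in
/-- (SP) inside any finset `E` for `1 ≤ j`, `2j + 1 ≤ #E`. -/
theorem puncturedNMP_in_all {E : Finset α} {j : ℕ} {D : Finset (Finset α)} (hD : IsCodeIn j E D)
    (hj1 : 1 ≤ j) (hn : 2 * j + 1 ≤ E.card) : PuncturedNMPIn j E D := by
  apply puncturedNMP_in_of_subtype hD
  apply puncturedNMP_all (isCode_image_toSub hD) hj1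
  rw [Fintype.card_coe]
  exact hn

end PercRepro.PuncturedLYM

namespace PercRepro.Cogirth

open Finset ThmH Skew

variable {α : Type} [DecidableEq α] {M : Matroid α} [M.Finite]

/-- **(NC) for every sparse paving matroid** with `r + 1 ≤ n` and `n + 2 ≤ 2r`, on any ground set. -/
theorem normConsAt_of_sparsePaving_all {r : ℕ} (hsp : IsSparsePavingF M r) (hr1 : r + 1 ≤ (gr M).card)
    (hn : (gr M).card + 2 ≤ 2 * r) : NormConsAt M := by
  intro U hU j
  have hr : r ≤ (gr M).card := by omega
  rcases Nat.lt_or_ge j ((gr M).card - r) with hlt | hge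
  · apply normConsStep_of_lt
    rw [hsp.1]
    omega
  rcases Nat.eq_or_lt_of_le hge with heq | hgt
  · rw [← heq]
    apply normConsStep_bottom_of_puncturedNMPIn hsp hn hU
    exact PuncturedLYM.puncturedNMP_in_all (isCodeIn_cocode hsp hr) (by omega) (by omega)
  rcases Nat.lt_or_ge (j + 1) r with hmid | htop
  · apply normConsStep_of_indep_succ_of_indep_sdiff hU (by omega)
    · intro S hS hSc
      exact rk_eq_card_of_card_lt_of_sparsePaving hsp hr hS (by omega)
    · intro S hS hSc
      exact rk_eq_card_of_card_lt_of_sparsePaving hsp hr hS (by omega)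
  · apply normConsStep_of_rk_le hU
    rw [hsp.1]
    omega

end PercRepro.Cogirth
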